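import Literature.NumberTheory.LFunctions.RodgersTaoGapsEnergyProofs
import Literature.NumberTheory.LFunctions.RodgersTaoGapsEnergy
import HarnessLib

/-!
# Rodgers–Tao 2020, Prop. 6.1 (weak bound on integrated energy) — RH-FREE CONTENT twin, Part I:
# the integrated Hamiltonian identity (Lemma 12 (v) + FTC) on a time interval above a real-rooted time

RH-FREE literature proofs (no definitions, no named facts, no `sorry`). Trunk T-ANT
(`Literature/NumberTheory/LFunctions`); companion of `RodgersTaoGapsEnergy.lean` (the typed,
VACUOUS-AS-PRINTED fact `Literature.NumberTheory.LFunctions.rodgers_tao_weak_energy_bound`,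
Rodgers–Tao 2020 Prop. 6.1 = FMP Prop. 15) and of `RodgersTaoGapsEnergyProofs.lean` (the CONTENT
twin of Lemma 5.2 and the uniform-tail / continuity tools for the cross energy). This file is
PART I of the C3 cell's programme «P6.1 CONTENT twin» (rt-lead ruling (46)(c), rt/STATUS
2026-08-26): the integrated form of Lemma 12 (v) that opens the printed proof of Prop. 15.

> B. Rodgers, T. Tao, *The de Bruijn–Newman constant is non-negative*, Forum Math. Pi 8 (2020)
> e6 (= arXiv:1801.05914v5), **Prop. 15** (p. 38) and its proof (p. 39): "Next, we apply
> Lemma 12(v) and use the fundamental theorem of calculus to obtain the identity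
> `Σ_{k,k'∈K: k≠k'} H_{kk'}(Λ/2) − H_{kk'}(0) = 4Q_K − 2∫_{Λ/2}^0 Σ_{j∉K; k,k'∈K: k≠k'}
> 1/((x_j(t)−x_k(t))(x_j(t)−x_{k'}(t))) dt`."; **Lemma 12 (v)** (p. 30): "`∂ₜ Σ_{k,k'∈K: k≠k'}
> H_{kk'} = −4 Σ_{k,k'∈K: k≠k'} E_{kk'} + 2 Σ_{j∉K; k,k'∈K: k≠k'} 1/((x_j − x_k)(x_j − x_{k'}))`".

House form (cell ruling R2 / C(2)(B)): the printed time range `Λ/2 ≤ t ≤ 0` is replaced by an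
arbitrary interval `[t₁, t₂]` above a real-rooted time `t₀ < t₁` (so `Λ ≤ t₀ < t₁`), where the
tree's Lemma 12 (v) `Literature.NumberTheory.LFunctions.rodgers_tao_hamiltonian_identity_holds`
(RH-FREE, typed for `t > Λ`) applies; nothing is asserted at `t ≤ 0 ≤ Λ`.

## Main results (all `theorem`s, 0 new facts)

* `continuousOn_rodgersTaoCrossSum`: for a finite `K ⊂ ℤ*` and `k, k' ∈ K`, the environment sum
  `S_{kk'}(t) = Σ_{j ∈ ℤ*∖K} 1/((x_j−x_k)(x_j−x_{k'}))` is continuous on `[t₁, t₂]` (uniform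
  tails, dominated by the cross energy — `exists_far_crossEnergy_le`);
* `continuousOn_sum_offDiag_interactionEnergy`: `t ↦ Σ_{k≠k'∈K} E_{kk'}(t)` is continuous there;
* `sum_offDiag_hamiltonianInteraction_sub_eq_integral` — **the integrated Lemma 12 (v)**:
  `Σ_{k≠k'} H_{kk'}(t₂) − Σ_{k≠k'} H_{kk'}(t₁)
   = ∫_{t₁}^{t₂} (−4 Σ_{k≠k'} E_{kk'}(t) + 2 Σ_{k≠k'} S_{kk'}(t)) dt`;
* `abs_sum_offDiag_rodgersTaoCrossSum_le`: `|Σ_{k≠k'} S_{kk'}(t)| ≤ (|K|−1)·B(t)`,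
  `B(t) = Σ_{k∈K} Σ_{j∉K} E_{jk}(t)` (AM–GM, `abs_rodgersTaoCrossTerm_le`; this is the printed
  "using `ab ≪ a² + b²`" step done with its honest factor `|K| − 1`, see the note below);
* `four_mul_integral_sum_offDiag_interactionEnergy_le`:
  `4∫_{t₁}^{t₂} Σ_{k≠k'} E_{kk'} ≤ Σ_{k≠k'} H_{kk'}(t₁) − Σ_{k≠k'} H_{kk'}(t₂) + 2(|K|−1)∫_{t₁}^{t₂} B`;
* skeletons for the two Hamiltonian terms: `sum_offDiag_hamiltonianInteraction_le` (a uniform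
  bound `H_{kk'}(t₁) ≤ M`, as Prop. 13 supplies, gives `≤ |K|(|K|−1)M`) and
  `neg_sum_offDiag_hamiltonianInteraction_le` (a spread bound `|x_k − x_{k'}| ≤ D`, as the location
  law supplies, gives `−Σ H_{kk'}(t₂) ≤ |K|(|K|−1) log D`).

NOTE for the referee (proof-route precision, statement-level none): the printed step "Using
`ab ≪ a² + b²`, we thus have `Q_K ≪ J² log^{O(1)} J + ∫ Σ_{j∉K, k∈K} (x_j−x_k)^{−2} dt`" (p. 39)
applied termwise over the ordered pairs `k ≠ k'` yields the factor `|K| − 1` recorded here; the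
parts of the printed argument that absorb this factor (location law (50) for indices far from `j`,
Cauchy–Schwarz only over `O(log² J)` near indices) belong to the later parts of this programme.

bears_on: N-C/N-P (COLUMN 3 DBN). WHAT THIS IS NOT: an identity/inequality for the zeros of `H_t`
at times above a real-rooted time — RH-free; the printed `Λ/2 ≤ t ≤ 0` instance of Prop. 15 is
VACUOUS-AS-PRINTED (`rodgers_tao_weak_energy_bound`, p422049); nothing here bears on the truth of
RH.

## References

* B. Rodgers, T. Tao, Forum Math. Pi 8 (2020) e6, Prop. 15 pp. 38–39, Lemma 12 p. 30,
  Lemma 14 pp. 34–35 (= arXiv:1801.05914v5 Prop. 6.1, Lemma 4.2, Lemma 5.2).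
-/

noncomputable section

open Set Filter Topology MeasureTheory intervalIntegral

namespace Literature.NumberTheory.LFunctions

/-! ### Continuity of the environment sums `S_{kk'}` and of the truncated energy -/

/-- A single environment term `1/((x_j − x_k)(x_j − x_{k'}))(t)` is continuous at every `t > Λ`
when `j ≠ k`, `j ≠ k'` (zeros move continuously, Thm. 11; the gaps do not vanish).
[cite: RodgersTaoFMP2020, Lemma 12 (v) p. 30] -/
theorem continuousAt_rodgersTaoCrossTerm {t : ℝ}
    (hΛ : ∃ t₁ : ℝ, t₁ < t ∧ HasOnlyRealZeros (deBruijnH t₁)) {k k' j : ℤ} (hjk : j ≠ k)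
    (hjk' : j ≠ k') : ContinuousAt (fun s ↦ rodgersTaoCrossTerm s k k' j) t := by
  have e : (fun s ↦ rodgersTaoCrossTerm s k k' j) = fun s ↦
      1 / ((deBruijnZeroZ s j - deBruijnZeroZ s k) * (deBruijnZeroZ s j - deBruijnZeroZ s k')) := by
    funext s; rw [rodgersTaoCrossTerm_eq]
  rw [e]
  refine continuousAt_const.div ?_ (mul_ne_zero (deBruijnZeroZ_sub_ne_zero hΛ hjk.symm)
    (deBruijnZeroZ_sub_ne_zero hΛ hjk'.symm))
  exact ((continuousAt_deBruijnZeroZ hΛ j).sub (continuousAt_deBruijnZeroZ hΛ k)).mul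
    ((continuousAt_deBruijnZeroZ hΛ j).sub (continuousAt_deBruijnZeroZ hΛ k'))

/-- `E_{jk}(t)` is continuous at every `t > Λ` when `j ≠ k`. [cite: RodgersTaoFMP2020, §4 p. 29 (58)] -/
theorem continuousAt_interactionEnergy {t : ℝ}
    (hΛ : ∃ t₁ : ℝ, t₁ < t ∧ HasOnlyRealZeros (deBruijnH t₁)) {j k : ℤ} (hjk : j ≠ k) :
    ContinuousAt (fun s ↦ interactionEnergy s j k) t := by
  have e : (fun s ↦ interactionEnergy s j k) =
      fun s ↦ 1 / (deBruijnZeroZ s j - deBruijnZeroZ s k) ^ 2 := by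
    funext s; rw [interactionEnergy_eq]
  rw [e]
  exact continuousAt_const.div (((continuousAt_deBruijnZeroZ hΛ j).sub
    (continuousAt_deBruijnZeroZ hΛ k)).pow 2) (pow_ne_zero 2 (deBruijnZeroZ_sub_ne_zero hΛ hjk.symm))

/-- **The truncated energy `Σ_{k≠k'∈K} E_{kk'}(t)` is continuous on `[t₁, t₂]`** (`Λ < t₁`).
[cite: RodgersTaoFMP2020, Prop. 15 proof p. 39 (the quantity Q_I)] -/
theorem continuousOn_sum_offDiag_interactionEnergy {t₀ t₁ t₂ : ℝ}
    (hreal : HasOnlyRealZeros (deBruijnH t₀)) (ht₀ : t₀ < t₁) (K : Finset ℤ) :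
    ContinuousOn (fun t ↦ ∑ p ∈ K.offDiag, interactionEnergy t p.1 p.2) (Icc t₁ t₂) := by
  refine continuousOn_finsetSum _ fun p hp t ht ↦ ?_
  have hΛt : ∃ t₁' : ℝ, t₁' < t ∧ HasOnlyRealZeros (deBruijnH t₁') :=
    ⟨t₀, lt_of_lt_of_le ht₀ ht.1, hreal⟩
  exact (continuousAt_interactionEnergy hΛt (Finset.mem_offDiag.1 hp).2.2).continuousWithinAt

/-- **Continuity of the environment sum** `S_{kk'}(t) = Σ_{j ∈ ℤ*∖K} 1/((x_j−x_k)(x_j−x_{k'}))`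
on `[t₁, t₂]` (`Λ < t₁`, `k, k' ∈ K`): uniform limit of the continuous window sums over
`[−R, R]_{ℤ*} ∖ K`, the tails being dominated by the far cross energy
`Σ_{|j|>R} (E_{jk} + E_{jk'})/2`, uniformly small on `[t₁, t₂]` (`exists_far_crossEnergy_le`;
"the sum defining `B(t)` is uniformly convergent", Lemma 14 proof p. 34).
[cite: RodgersTaoFMP2020, Lemma 12 (v) p. 30 and Lemma 14 proof p. 34] -/
theorem continuousOn_rodgersTaoCrossSum {t₀ t₁ t₂ : ℝ} (hreal : HasOnlyRealZeros (deBruijnH t₀))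
    (ht₀ : t₀ < t₁) (K : Finset ℤ) (hK0 : (0 : ℤ) ∉ K) {k k' : ℤ} (hk : k ∈ K) (hk' : k' ∈ K) :
    ContinuousOn (fun t ↦ rodgersTaoCrossSum t K k k') (Icc t₁ t₂) := by
  classical
  have hΛs : ∀ t ∈ Icc t₁ t₂, ∃ t₁' : ℝ, t₁' < t ∧ HasOnlyRealZeros (deBruijnH t₁') :=
    fun t ht ↦ ⟨t₀, lt_of_lt_of_le ht₀ ht.1, hreal⟩
  set F : ℕ → ℝ → ℝ := fun R t ↦
    ∑ j ∈ zstarIcc (-(R : ℤ)) R \ K, rodgersTaoCrossTerm t k k' j with hF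
  -- the window sums are continuous
  have hFcont : ∀ R : ℕ, ContinuousOn (F R) (Icc t₁ t₂) := by
    intro R
    refine continuousOn_finsetSum _ fun j hj t ht ↦ ?_
    have hjK : j ∉ K := (Finset.mem_sdiff.1 hj).2
    have hjk : j ≠ k := fun h ↦ hjK (h ▸ hk)
    have hjk' : j ≠ k' := fun h ↦ hjK (h ▸ hk')
    exact (continuousAt_rodgersTaoCrossTerm (hΛs t ht) hjk hjk').continuousWithinAt
  -- uniform convergence
  have hU : TendstoUniformlyOn F (fun t ↦ rodgersTaoCrossSum t K k k') atTop (Icc t₁ t₂) := by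
    refine Metric.tendstoUniformlyOn_iff.2 fun ε hε ↦ ?_
    obtain ⟨R₁, hR₁K, hR₁⟩ := exists_far_crossEnergy_le (t₂ := t₂) hreal ht₀ K (half_pos hε)
    refine eventually_atTop.2 ⟨R₁, fun R hR t ht ↦ ?_⟩
    have hKR : K ⊆ zstarIcc (-(R : ℤ)) R := subset_zstarIcc_of_le hK0 (hR₁K.trans hR)
    have hΛt := hΛs t ht
    have hsum := summable_rodgersTaoCrossTerm_int hΛt k k'
    rw [Real.dist_eq]
    have hsplit : rodgersTaoCrossSum t K k k' - F R t =
        ∑' j : ↥((↑(Finset.Icc (-(R : ℤ)) R) : Set ℤ)ᶜ), rodgersTaoCrossTerm t k k' j := by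
      simp only [hF]
      rw [rodgersTaoCrossSum_eq, tsum_zstarCompl_eq_sum_add_tsum hsum hKR]
      ring
    rw [hsplit]
    -- domination of the tail by the far cross energies of `k` and `k'`
    have hEk := summable_interactionEnergy_int hΛt k
    have hEk' := summable_interactionEnergy_int hΛt k'
    set C : Set ℤ := (↑(Finset.Icc (-(R : ℤ)) R) : Set ℤ)ᶜ with hC
    have hEkC : Summable fun j : C ↦ interactionEnergy t j k := hEk.subtype C
    have hEk'C : Summable fun j : C ↦ interactionEnergy t j k' := hEk'.subtype C
    have hmaj : Summable fun j : C ↦ (interactionEnergy t j k + interactionEnergy t j k') / 2 :=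
      (hEkC.add hEk'C).div_const 2
    have hle : ∀ j : C, ‖rodgersTaoCrossTerm t k k' j‖ ≤
        (interactionEnergy t j k + interactionEnergy t j k') / 2 := fun j ↦ by
      rw [Real.norm_eq_abs]; exact abs_rodgersTaoCrossTerm_le t k k' j
    have hnorm : Summable fun j : C ↦ ‖rodgersTaoCrossTerm t k k' j‖ :=
      Summable.of_nonneg_of_le (fun j ↦ norm_nonneg _) hle hmaj
    have h1 := hR₁ R hR t ht k hk
    have h2 := hR₁ R hR t ht k' hk'
    calc |∑' j : C, rodgersTaoCrossTerm t k k' j|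
        = ‖∑' j : C, rodgersTaoCrossTerm t k k' j‖ := (Real.norm_eq_abs _).symm
      _ ≤ ∑' j : C, ‖rodgersTaoCrossTerm t k k' j‖ := norm_tsum_le_tsum_norm hnorm
      _ ≤ ∑' j : C, (interactionEnergy t j k + interactionEnergy t j k') / 2 :=
          hnorm.tsum_le_tsum hle hmaj
      _ = (∑' j : C, interactionEnergy t j k + ∑' j : C, interactionEnergy t j k') / 2 := by
          rw [← hEkC.tsum_add hEk'C, ← tsum_div_const]
      _ ≤ (ε / 2 + ε / 2) / 2 := by gcongr
      _ < ε := by linarith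
  exact hU.continuousOn (Frequently.of_forall hFcont)

/-- `t ↦ Σ_{k≠k'∈K} S_{kk'}(t)` is continuous on `[t₁, t₂]` (`Λ < t₁`). [cite: RodgersTaoFMP2020, Lemma 12 (v) p. 30] -/
theorem continuousOn_sum_offDiag_rodgersTaoCrossSum {t₀ t₁ t₂ : ℝ}
    (hreal : HasOnlyRealZeros (deBruijnH t₀)) (ht₀ : t₀ < t₁) (K : Finset ℤ) (hK0 : (0 : ℤ) ∉ K) :
    ContinuousOn (fun t ↦ ∑ p ∈ K.offDiag, rodgersTaoCrossSum t K p.1 p.2) (Icc t₁ t₂) :=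
  continuousOn_finsetSum _ fun _ hp ↦ continuousOn_rodgersTaoCrossSum (t₂ := t₂) hreal ht₀ K hK0
    (Finset.mem_offDiag.1 hp).1 (Finset.mem_offDiag.1 hp).2.1

/-! ### The integrated Lemma 12 (v) -/

/-- **Lemma 12 (v) integrated over `[t₁, t₂]`** (`Λ < t₁ ≤ t₂`; the identity that opens the
proof of Prop. 15, p. 39, in house time-translated form):
`Σ_{k≠k'∈K} H_{kk'}(t₂) − Σ_{k≠k'∈K} H_{kk'}(t₁) = ∫_{t₁}^{t₂} (−4 Σ_{k≠k'} E_{kk'}(t) + 2 Σ_{k≠k'} S_{kk'}(t)) dt`,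
from the tree's `rodgers_tao_hamiltonian_identity_holds` (the derivative at every `t > Λ`) and the
fundamental theorem of calculus, the derivative being continuous on `[t₁, t₂]`.
[cite: RodgersTaoFMP2020, Prop. 15 proof p. 39 (FTC display) and Lemma 12 (v) p. 30] -/
theorem sum_offDiag_hamiltonianInteraction_sub_eq_integral {t₀ t₁ t₂ : ℝ}
    (hreal : HasOnlyRealZeros (deBruijnH t₀)) (ht₀ : t₀ < t₁) (h₁₂ : t₁ ≤ t₂) (K : Finset ℤ)
    (hK0 : (0 : ℤ) ∉ K) :
    ∑ p ∈ K.offDiag, hamiltonianInteraction t₂ p.1 p.2 -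
        ∑ p ∈ K.offDiag, hamiltonianInteraction t₁ p.1 p.2 =
      ∫ t in t₁..t₂, (-4 * ∑ p ∈ K.offDiag, interactionEnergy t p.1 p.2 +
        2 * ∑ p ∈ K.offDiag, rodgersTaoCrossSum t K p.1 p.2) := by
  have hderiv : ∀ t ∈ uIcc t₁ t₂, HasDerivAt (fun s ↦ ∑ p ∈ K.offDiag, hamiltonianInteraction s p.1 p.2)
      (-4 * ∑ p ∈ K.offDiag, interactionEnergy t p.1 p.2 +
        2 * ∑ p ∈ K.offDiag, rodgersTaoCrossSum t K p.1 p.2) t := by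
    intro t ht
    rw [uIcc_of_le h₁₂] at ht
    exact (rodgers_tao_hamiltonian_identity_holds t ⟨t₀, lt_of_lt_of_le ht₀ ht.1, hreal⟩ K hK0).2
  have hcont : ContinuousOn (fun t ↦ -4 * ∑ p ∈ K.offDiag, interactionEnergy t p.1 p.2 +
      2 * ∑ p ∈ K.offDiag, rodgersTaoCrossSum t K p.1 p.2) (uIcc t₁ t₂) := by
    rw [uIcc_of_le h₁₂]
    exact (continuousOn_const.mul (continuousOn_sum_offDiag_interactionEnergy hreal ht₀ K)).add
      (continuousOn_const.mul (continuousOn_sum_offDiag_rodgersTaoCrossSum hreal ht₀ K hK0))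
  exact (integral_eq_sub_of_hasDerivAt hderiv hcont.intervalIntegrable).symm

/-! ### The environment sums against the cross energy `B(t) = Σ_{k∈K} Σ_{j∉K} E_{jk}(t)` -/

/-- `|S_{kk'}(t)| ≤ (B_k(t) + B_{k'}(t))/2`, `B_k = Σ_{j∉K} E_{jk}` (AM–GM termwise,
`abs_rodgersTaoCrossTerm_le`). [cite: RodgersTaoFMP2020, Prop. 15 proof p. 39 ("using ab ≪ a² + b²")] -/
theorem abs_rodgersTaoCrossSum_le_half_add {t : ℝ}
    (hΛ : ∃ t₁ : ℝ, t₁ < t ∧ HasOnlyRealZeros (deBruijnH t₁)) (K : Finset ℤ) (k k' : ℤ) :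
    |rodgersTaoCrossSum t K k k'| ≤
      (∑' j : zstarCompl K, interactionEnergy t j k + ∑' j : zstarCompl K, interactionEnergy t j k') / 2 := by
  have hEk : Summable fun j : zstarCompl K ↦ interactionEnergy t j k :=
    (summable_interactionEnergy_int hΛ k).subtype _
  have hEk' : Summable fun j : zstarCompl K ↦ interactionEnergy t j k' :=
    (summable_interactionEnergy_int hΛ k').subtype _
  have hmaj : Summable fun j : zstarCompl K ↦
      (interactionEnergy t j k + interactionEnergy t j k') / 2 := (hEk.add hEk').div_const 2
  have hle : ∀ j : zstarCompl K, ‖rodgersTaoCrossTerm t k k' j‖ ≤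
      (interactionEnergy t j k + interactionEnergy t j k') / 2 := fun j ↦ by
    rw [Real.norm_eq_abs]; exact abs_rodgersTaoCrossTerm_le t k k' j
  have hnorm : Summable fun j : zstarCompl K ↦ ‖rodgersTaoCrossTerm t k k' j‖ :=
    Summable.of_nonneg_of_le (fun j ↦ norm_nonneg _) hle hmaj
  rw [rodgersTaoCrossSum]
  calc |∑' j : zstarCompl K, rodgersTaoCrossTerm t k k' j|
      = ‖∑' j : zstarCompl K, rodgersTaoCrossTerm t k k' j‖ := (Real.norm_eq_abs _).symm
    _ ≤ ∑' j : zstarCompl K, ‖rodgersTaoCrossTerm t k k' j‖ := norm_tsum_le_tsum_norm hnorm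
    _ ≤ ∑' j : zstarCompl K, (interactionEnergy t j k + interactionEnergy t j k') / 2 :=
        hnorm.tsum_le_tsum hle hmaj
    _ = (∑' j : zstarCompl K, interactionEnergy t j k +
          ∑' j : zstarCompl K, interactionEnergy t j k') / 2 := by
        rw [← hEk.tsum_add hEk', ← tsum_div_const]

/-- Bookkeeping over ordered pairs: `Σ_{(k,k')∈K.offDiag} g(k) = (|K| − 1) Σ_{k∈K} g(k)`.
[cite: RodgersTaoFMP2020, Prop. 15 proof p. 39] -/
theorem sum_offDiag_fst_eq (K : Finset ℤ) (g : ℤ → ℝ) :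
    ∑ p ∈ K.offDiag, g p.1 = ((K.card : ℝ) - 1) * ∑ k ∈ K, g k := by
  classical
  have h := Finset.sum_union (Finset.disjoint_diag_offDiag K) (f := fun p : ℤ × ℤ ↦ g p.1)
  rw [Finset.diag_union_offDiag, Finset.sum_product, Finset.diag, Finset.sum_map] at h
  simp only [Finset.sum_const, nsmul_eq_mul, Function.Embedding.coeFn_mk] at h
  rw [← Finset.mul_sum] at h
  linarith

/-- Bookkeeping over ordered pairs: `Σ_{(k,k')∈K.offDiag} g(k') = (|K| − 1) Σ_{k∈K} g(k)`.
[cite: RodgersTaoFMP2020, Prop. 15 proof p. 39] -/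
theorem sum_offDiag_snd_eq (K : Finset ℤ) (g : ℤ → ℝ) :
    ∑ p ∈ K.offDiag, g p.2 = ((K.card : ℝ) - 1) * ∑ k ∈ K, g k := by
  classical
  have h := Finset.sum_union (Finset.disjoint_diag_offDiag K) (f := fun p : ℤ × ℤ ↦ g p.2)
  rw [Finset.diag_union_offDiag, Finset.sum_product, Finset.diag, Finset.sum_map] at h
  simp only [Function.Embedding.coeFn_mk] at h
  rw [Finset.sum_comm] at h
  simp only [Finset.sum_const, nsmul_eq_mul] at h
  rw [← Finset.mul_sum] at h
  linarith

/-- **The environment sums against the cross energy**: for `t > Λ` and a finite `K ⊂ ℤ*`,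
`|Σ_{k≠k'∈K} S_{kk'}(t)| ≤ (|K| − 1) · B(t)`, `B(t) = Σ_{k∈K} Σ_{j∈ℤ*∖K} E_{jk}(t)` — the printed
step "using `ab ≪ a² + b²`" (p. 39) carried out termwise over the ordered pairs, with its honest
factor `|K| − 1` (see the module docstring). [cite: RodgersTaoFMP2020, Prop. 15 proof p. 39] -/
theorem abs_sum_offDiag_rodgersTaoCrossSum_le {t : ℝ}
    (hΛ : ∃ t₁ : ℝ, t₁ < t ∧ HasOnlyRealZeros (deBruijnH t₁)) (K : Finset ℤ) :
    |∑ p ∈ K.offDiag, rodgersTaoCrossSum t K p.1 p.2| ≤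
      ((K.card : ℝ) - 1) * ∑ k ∈ K, ∑' j : zstarCompl K, interactionEnergy t j k := by
  set B : ℤ → ℝ := fun k ↦ ∑' j : zstarCompl K, interactionEnergy t j k with hB
  calc |∑ p ∈ K.offDiag, rodgersTaoCrossSum t K p.1 p.2|
      ≤ ∑ p ∈ K.offDiag, |rodgersTaoCrossSum t K p.1 p.2| := Finset.abs_sum_le_sum_abs _ _
    _ ≤ ∑ p ∈ K.offDiag, (B p.1 + B p.2) / 2 :=
        Finset.sum_le_sum fun p _ ↦ abs_rodgersTaoCrossSum_le_half_add hΛ K p.1 p.2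
    _ = (∑ p ∈ K.offDiag, B p.1 + ∑ p ∈ K.offDiag, B p.2) / 2 := by
        rw [← Finset.sum_add_distrib, Finset.sum_div]
    _ = ((K.card : ℝ) - 1) * ∑ k ∈ K, B k := by
        rw [sum_offDiag_fst_eq, sum_offDiag_snd_eq]; ring

/-! ### The basic inequality for `Q_K` -/

/-- **The basic inequality behind Prop. 15** (house time-translated form, `Λ < t₁ ≤ t₂`, finite
`K ⊂ ℤ*`): `4 ∫_{t₁}^{t₂} Σ_{k≠k'∈K} E_{kk'}(t) dt ≤ Σ_{k≠k'} H_{kk'}(t₁) − Σ_{k≠k'} H_{kk'}(t₂)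
+ 2 (|K| − 1) ∫_{t₁}^{t₂} B(t) dt` — the integrated Lemma 12 (v) followed by the environment
estimate ("thus `Q_K ≪ J² log^{O(1)} J + ∫ Σ …`", p. 39, before the location law enters).
[cite: RodgersTaoFMP2020, Prop. 15 proof p. 39] -/
theorem four_mul_integral_sum_offDiag_interactionEnergy_le {t₀ t₁ t₂ : ℝ}
    (hreal : HasOnlyRealZeros (deBruijnH t₀)) (ht₀ : t₀ < t₁) (h₁₂ : t₁ ≤ t₂) (K : Finset ℤ)
    (hK0 : (0 : ℤ) ∉ K) :
    4 * ∫ t in t₁..t₂, ∑ p ∈ K.offDiag, interactionEnergy t p.1 p.2 ≤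
      (∑ p ∈ K.offDiag, hamiltonianInteraction t₁ p.1 p.2 -
          ∑ p ∈ K.offDiag, hamiltonianInteraction t₂ p.1 p.2) +
        2 * (((K.card : ℝ) - 1) *
          ∫ t in t₁..t₂, ∑ k ∈ K, ∑' j : zstarCompl K, interactionEnergy t j k) := by
  have hΛs : ∀ t ∈ Icc t₁ t₂, ∃ t₁' : ℝ, t₁' < t ∧ HasOnlyRealZeros (deBruijnH t₁') :=
    fun t ht ↦ ⟨t₀, lt_of_lt_of_le ht₀ ht.1, hreal⟩
  have hid := sum_offDiag_hamiltonianInteraction_sub_eq_integral hreal ht₀ h₁₂ K hK0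
  have hE : IntervalIntegrable (fun t ↦ ∑ p ∈ K.offDiag, interactionEnergy t p.1 p.2) volume t₁ t₂ :=
    ((continuousOn_sum_offDiag_interactionEnergy hreal ht₀ K).mono (by rw [uIcc_of_le h₁₂])).intervalIntegrable
  have hS : IntervalIntegrable (fun t ↦ ∑ p ∈ K.offDiag, rodgersTaoCrossSum t K p.1 p.2) volume t₁ t₂ :=
    ((continuousOn_sum_offDiag_rodgersTaoCrossSum hreal ht₀ K hK0).mono
      (by rw [uIcc_of_le h₁₂])).intervalIntegrable
  have hBc : IntervalIntegrable
      (fun t ↦ ∑ k ∈ K, ∑' j : zstarCompl K, interactionEnergy t j k) volume t₁ t₂ :=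
    ((continuousOn_crossEnergy (t₂ := t₂) hreal ht₀ K hK0).mono
      (by rw [uIcc_of_le h₁₂])).intervalIntegrable
  rw [intervalIntegral.integral_add (hE.const_mul (-4)) (hS.const_mul 2),
    intervalIntegral.integral_const_mul, intervalIntegral.integral_const_mul] at hid
  have hSle : ∫ t in t₁..t₂, ∑ p ∈ K.offDiag, rodgersTaoCrossSum t K p.1 p.2 ≤
      ∫ t in t₁..t₂, ((K.card : ℝ) - 1) * ∑ k ∈ K, ∑' j : zstarCompl K, interactionEnergy t j k :=
    intervalIntegral.integral_mono_on h₁₂ hS (hBc.const_mul _) fun t ht ↦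
      (le_abs_self _).trans (abs_sum_offDiag_rodgersTaoCrossSum_le (hΛs t ht) K)
  rw [intervalIntegral.integral_const_mul] at hSle
  linarith

/-! ### The two Hamiltonian terms: skeleton bounds -/

/-- `|K.offDiag| = |K|(|K| − 1)` as real numbers. [cite: RodgersTaoFMP2020, Prop. 15 proof p. 39] -/
theorem card_offDiag_cast (K : Finset ℤ) : (K.offDiag.card : ℝ) = K.card * ((K.card : ℝ) - 1) := by
  rw [Finset.offDiag_card, Nat.cast_sub (Nat.le_mul_self _), Nat.cast_mul]
  ring

/-- **Upper bound for `Σ_{k≠k'} H_{kk'}(t₁)` from a uniform bound on the `H_{kk'}`** (the role of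
Prop. 13 at the left end-point: "From Proposition 13, the left-hand side is `O(J² log^{O(1)} J)`",
p. 39): if `H_{kk'}(t) ≤ M` for all `k ≠ k'` in `K`, then `Σ_{k≠k'∈K} H_{kk'}(t) ≤ |K|(|K|−1) M`.
[cite: RodgersTaoFMP2020, Prop. 15 proof p. 39] -/
theorem sum_offDiag_hamiltonianInteraction_le {t M : ℝ} (K : Finset ℤ)
    (hM : ∀ p ∈ K.offDiag, hamiltonianInteraction t p.1 p.2 ≤ M) :
    ∑ p ∈ K.offDiag, hamiltonianInteraction t p.1 p.2 ≤ K.card * ((K.card : ℝ) - 1) * M := by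
  rw [← card_offDiag_cast]
  have h := Finset.sum_le_card_nsmul K.offDiag (fun p ↦ hamiltonianInteraction t p.1 p.2) M hM
  rwa [nsmul_eq_mul] at h

/-- **Lower bound for `Σ_{k≠k'} H_{kk'}(t₂)` from a bound on the spread of the zeros** (the role of
the location law at the right end-point): if `|x_k(t) − x_{k'}(t)| ≤ D` (`D ≥ 1`) for all
`k ≠ k'` in `K`, then `−Σ_{k≠k'∈K} H_{kk'}(t) = Σ log|x_k − x_{k'}| ≤ |K|(|K|−1) log D`.
[cite: RodgersTaoFMP2020, Prop. 15 proof p. 39] -/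
theorem neg_sum_offDiag_hamiltonianInteraction_le {t D : ℝ} (K : Finset ℤ) (hD : 1 ≤ D)
    (hKD : ∀ p ∈ K.offDiag, |deBruijnZeroZ t p.1 - deBruijnZeroZ t p.2| ≤ D) :
    -∑ p ∈ K.offDiag, hamiltonianInteraction t p.1 p.2 ≤ K.card * ((K.card : ℝ) - 1) * Real.log D := by
  rw [← card_offDiag_cast, ← Finset.sum_neg_distrib]
  have hle : ∀ p ∈ K.offDiag, -hamiltonianInteraction t p.1 p.2 ≤ Real.log D := by
    intro p hp
    rw [hamiltonianInteraction_eq_neg_log, neg_neg]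
    rcases eq_or_lt_of_le (abs_nonneg (deBruijnZeroZ t p.1 - deBruijnZeroZ t p.2)) with h0 | hpos
    · rw [← h0, Real.log_zero]; exact Real.log_nonneg hD
    · exact Real.log_le_log hpos (hKD p hp)
  have h := Finset.sum_le_card_nsmul K.offDiag (fun p ↦ -hamiltonianInteraction t p.1 p.2)
    (Real.log D) hle
  rwa [nsmul_eq_mul] at h

/-- The spread hypothesis of `neg_sum_offDiag_hamiltonianInteraction_le` from a bound on the zeros
themselves: `|x_k(t)| ≤ D/2` for `k ∈ K` gives `|x_k − x_{k'}| ≤ D`. [cite: RodgersTaoFMP2020, Prop. 15 proof p. 39] -/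
theorem abs_sub_le_of_abs_le {t D : ℝ} (K : Finset ℤ)
    (hKD : ∀ k ∈ K, |deBruijnZeroZ t k| ≤ D / 2) :
    ∀ p ∈ K.offDiag, |deBruijnZeroZ t p.1 - deBruijnZeroZ t p.2| ≤ D := by
  intro p hp
  obtain ⟨h1, h2, -⟩ := Finset.mem_offDiag.1 hp
  calc |deBruijnZeroZ t p.1 - deBruijnZeroZ t p.2| ≤ |deBruijnZeroZ t p.1| + |deBruijnZeroZ t p.2| :=
        abs_sub _ _
    _ ≤ D / 2 + D / 2 := add_le_add (hKD _ h1) (hKD _ h2)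
    _ = D := by ring

end Literature.NumberTheory.LFunctions

end
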